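import Literature.NumberTheory.ModularForms.SiegelThetaConstantsPhiOperator
import Literature.NumberTheory.ModularForms.SiegelModularFormSpace
import HarnessLib

/-!
# The Siegel operator is multiplicative; the cusp forms form an ideal

Layer `Literature/NumberTheory/ModularForms`, namespace `Literature.NumberTheory.ModularForms.SiegelModularForm`
(lane `lit-hodgefound`, Layer A4, theta-divisor row A4-17; prover seat `lit-hodgefound-p23`, row «A4-17(ae)»).
On top of the tree's Siegel operator `siegelPhi` (`SiegelPhiOperator.lean`, Klingen §5 Prop. 1 (3):
`f|Φ(Z) = lim_{λ→∞} f((Z 0; 0 iλ))`, the limit existing for modular forms, `tendsto_siegelPhi'`), cusp forms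
`IsSiegelCuspForm` (`SiegelCuspForms.lean`, §5 Def. 1) and the linear spaces `space n k = M_n^k`,
`cuspSpace n k = S_n^k` (`SiegelModularFormSpace.lean`, prover p25), and of the theta cusp forms of
`SiegelThetaConstantsPhiOperator.lean`.

Sources followed (held texts). G. van der Geer, *Siegel modular forms and their applications* [held
p0046 L14]: "The Siegel operator is multiplicative: `Φ(F · F′) = Φ(F) Φ(F′)`."; [p0010 L13] "Together
these spaces form a graded ring `M^{cl} := ⊕ M_k` of classical Siegel modular forms"; [p0017 L59] "the
ideal of cusp forms"; [p0012 Def. 5.2] "A modular form `f ∈ M_ρ` is called a cusp form if `Φf = 0`."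
H. Klingen, §5 Prop. 1 (3) and Definition 1 (p. 55–56): "`S_n^k` … is the kernel of `Φ`". The proofs are
the one-liners of the sources: the limit of a product is the product of the limits.

What is here (theorems only; no definition, no named fact, net debt `0`).

* §1 `IsSiegelModularForm.one`, `.const`, `.pow`, `.finsetProd` (weight `0` constants; weights add under
  products — the graded ring `⊕_k M_n^k`), `siegelPhi_const`.
* §2 **`IsSiegelModularForm.siegelPhi_mul`: `(fg)|Φ = (f|Φ)(g|Φ)`** on `𝔥_n` for modular `f, g` of degree
  `n + 1`; `IsSiegelModularForm.siegelPhi_pow`, `IsSiegelModularForm.siegelPhi_finsetProd`.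
* §3 **the ideal of cusp forms**: `IsSiegelCuspForm.mul` / `.mul_left` (cusp × modular is cusp, weights
  add), `.pow`, `mul_mem_cuspSpace` / `mul_mem_cuspSpace'` (`S_{n+1}^{k₁} · M_{n+1}^{k₂} ⊆ S_{n+1}^{k₁+k₂}`).
* §4 consequences for the theta cusp form `χ := (∏_{m even} ϑ_m)⁸ ∈ S_w(Γ_{n+1})`, `w = 2^{n+2}(2^{n+1}+1)`:
  `P₈ · χ ∈ S_{4+w}`, `χ^m ∈ S_{mw}` and **`S_{mw}(Γ_{n+1}) ≠ 0` for every `m ≥ 1`**, every degree `n + 1 ≥ 1`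
  (`exists_isSiegelCuspForm_apply_ne_zero_mul`).

## References

* [vanderGeer2008] G. van der Geer, *Siegel modular forms and their applications*, in *The 1-2-3 of
  Modular Forms* (2008), §3 (p. 10), §5 Def. 5.1–5.2 (p. 12), §9 (p. 17), §25 (p. 46 L14 of the held
  text: "The Siegel operator is multiplicative").
* [Klingen1990] H. Klingen, *Introductory Lectures on Siegel Modular Forms* (1990), §4 Definition (p. 43),
  §5 Prop. 1 (3) (p. 55), Definition 1 (p. 56).
-/

noncomputable section

open Complex Real Matrix Filter Topology
open scoped Matrix.Norms.Elementwise
open Literature.Analysis.SpecialFunctions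
open Literature.NumberTheory.Automorphic (siegelUpperHalfSpace)
open Literature.NumberTheory.ModularForms.SiegelUpperHalfSpace
open Literature.Geometry.Kaehler.ComplexTorus

namespace Literature.NumberTheory.ModularForms

namespace SiegelModularForm

variable {n : ℕ} {k k₁ k₂ : ℤ}

/-! ### §1 The graded ring: constants, powers, products -/

section Ring

variable {f : Matrix (Fin n) (Fin n) ℂ → ℂ}

/-- **Constants are modular forms of weight `0`** (holomorphic, `c = det(γZ + δ)⁰ c`, bounded).
[cite: Klingen1990, §4 Definition (p. 43)] [cite: vanderGeer2008, §3 (p. 10 of the held text)] -/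
theorem IsSiegelModularForm.const (c : ℂ) : IsSiegelModularForm 0 (fun _ : Matrix (Fin n) (Fin n) ℂ => c) where
  differentiableOn := differentiableOn_const c
  transform M hM Z hZ := by rw [zpow_zero, one_mul]
  bounded_of_eq_one _ _ _ := ⟨‖c‖, fun _ _ _ => le_rfl⟩

/-- `1 ∈ M_n^0`. [cite: Klingen1990, §4 Definition (p. 43)] [cite: vanderGeer2008, §3 (p. 10 of the held text)] -/
theorem IsSiegelModularForm.one : IsSiegelModularForm 0 (1 : Matrix (Fin n) (Fin n) ℂ → ℂ) :=
  IsSiegelModularForm.const 1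

/-- **Weights add under powers: `f ∈ M_n^k ⇒ f^m ∈ M_n^{mk}`** (the graded ring `⊕_k M_n^k`).
[cite: vanderGeer2008, §3 (p. 10 of the held text) "Together these spaces form a graded ring"]
[cite: Klingen1990, §4 Definition (p. 43)] -/
theorem IsSiegelModularForm.pow (hf : IsSiegelModularForm k f) (m : ℕ) :
    IsSiegelModularForm ((m : ℤ) * k) (f ^ m) := by
  induction m with
  | zero =>
    rw [pow_zero, Nat.cast_zero, zero_mul]
    exact IsSiegelModularForm.one
  | succ m ih =>
    rw [pow_succ, Nat.cast_succ, add_mul, one_mul]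
    exact ih.mul hf

/-- **Weights add under finite products: `fᵢ ∈ M_n^{kᵢ} ⇒ ∏ᵢ fᵢ ∈ M_n^{Σᵢ kᵢ}`.**
[cite: vanderGeer2008, §3 (p. 10 of the held text) "Together these spaces form a graded ring"]
[cite: Klingen1990, §4 Definition (p. 43)] -/
theorem IsSiegelModularForm.finsetProd {ι : Type*} (s : Finset ι) {F : ι → Matrix (Fin n) (Fin n) ℂ → ℂ}
    {w : ι → ℤ} (h : ∀ i ∈ s, IsSiegelModularForm (w i) (F i)) :
    IsSiegelModularForm (∑ i ∈ s, w i) (∏ i ∈ s, F i) := by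
  classical
  induction s using Finset.induction_on with
  | empty =>
    rw [Finset.sum_empty, Finset.prod_empty]
    exact IsSiegelModularForm.one
  | insert a s ha ih =>
    rw [Finset.sum_insert ha, Finset.prod_insert ha]
    exact (h a (Finset.mem_insert_self a s)).mul (ih fun i hi => h i (Finset.mem_insert_of_mem hi))

/-- `c|Φ = c` for a constant `c` (degree `n + 1 → n`). [cite: Klingen1990, §5 Prop. 1 (3) (p. 55)] -/
theorem siegelPhi_const (c : ℂ) (Z : Matrix (Fin n) (Fin n) ℂ) :
    siegelPhi (fun _ : Matrix (Fin (n + 1)) (Fin (n + 1)) ℂ => c) Z = c :=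
  (tendsto_const_nhds (x := c) (f := (atTop : Filter ℝ))).limUnder_eq

end Ring

/-! ### §2 "The Siegel operator is multiplicative: `Φ(F · F′) = Φ(F) Φ(F′)`" -/

section Multiplicative

variable {f g : Matrix (Fin (n + 1)) (Fin (n + 1)) ℂ → ℂ}

/-- **`Φ(F · F′) = Φ(F) Φ(F′)`** on `𝔥_n`, for modular forms `F, F′` of degree `n + 1` (any weights): the
limit (3) of a product is the product of the limits (`tendsto_siegelPhi'`).
[cite: vanderGeer2008, §25 (p. 46 L14 of the held text) "The Siegel operator is multiplicative"]
[cite: Klingen1990, §5 Prop. 1 (3) (p. 55)] -/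
theorem IsSiegelModularForm.siegelPhi_mul (hf : IsSiegelModularForm k₁ f) (hg : IsSiegelModularForm k₂ g)
    {Z : Matrix (Fin n) (Fin n) ℂ} (hZ : Z ∈ siegelUpperHalfSpace n) :
    SiegelModularForm.siegelPhi (f * g) Z = SiegelModularForm.siegelPhi f Z * SiegelModularForm.siegelPhi g Z :=
  ((hf.tendsto_siegelPhi' hZ).mul (hg.tendsto_siegelPhi' hZ)).limUnder_eq

/-- **`Φ(F^m) = Φ(F)^m`** on `𝔥_n`. [cite: vanderGeer2008, §25 (p. 46 L14 of the held text)]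
[cite: Klingen1990, §5 Prop. 1 (3) (p. 55)] -/
theorem IsSiegelModularForm.siegelPhi_pow (hf : IsSiegelModularForm k f) (m : ℕ)
    {Z : Matrix (Fin n) (Fin n) ℂ} (hZ : Z ∈ siegelUpperHalfSpace n) :
    SiegelModularForm.siegelPhi (f ^ m) Z = SiegelModularForm.siegelPhi f Z ^ m :=
  ((hf.tendsto_siegelPhi' hZ).pow m).limUnder_eq

/-- **`Φ(∏ᵢ Fᵢ) = ∏ᵢ Φ(Fᵢ)`** on `𝔥_n`, for finitely many modular forms `Fᵢ` of degree `n + 1`.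
[cite: vanderGeer2008, §25 (p. 46 L14 of the held text)] [cite: Klingen1990, §5 Prop. 1 (3) (p. 55)] -/
theorem IsSiegelModularForm.siegelPhi_finsetProd {ι : Type*} (s : Finset ι)
    {F : ι → Matrix (Fin (n + 1)) (Fin (n + 1)) ℂ → ℂ} {w : ι → ℤ} (h : ∀ i ∈ s, IsSiegelModularForm (w i) (F i))
    {Z : Matrix (Fin n) (Fin n) ℂ} (hZ : Z ∈ siegelUpperHalfSpace n) :
    SiegelModularForm.siegelPhi (∏ i ∈ s, F i) Z = ∏ i ∈ s, SiegelModularForm.siegelPhi (F i) Z := by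
  have ht := tendsto_finsetProd s fun i hi => (h i hi).tendsto_siegelPhi' hZ
  exact (ht.congr fun t => (Finset.prod_apply _ s F).symm).limUnder_eq

end Multiplicative

/-! ### §3 "The ideal of cusp forms": `S^{k₁} · M^{k₂} ⊆ S^{k₁+k₂}` -/

section Ideal

variable {f g : Matrix (Fin (n + 1)) (Fin (n + 1)) ℂ → ℂ}

/-- **Cusp form × modular form is a cusp form** (weights add): `f|Φ = 0 ⇒ (fg)|Φ = (f|Φ)(g|Φ) = 0`.
[cite: vanderGeer2008, §9 (p. 17 of the held text) "the ideal of cusp forms", §25 (p. 46 L14)]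
[cite: Klingen1990, §5 Definition 1 (p. 56)] -/
theorem IsSiegelCuspForm.mul (hf : IsSiegelCuspForm k₁ f) (hg : IsSiegelModularForm k₂ g) :
    IsSiegelCuspForm (k₁ + k₂) (f * g) :=
  ⟨hf.1.mul hg, fun Z hZ => by rw [hf.1.siegelPhi_mul hg hZ, hf.2 Z hZ, zero_mul]⟩

/-- **Modular form × cusp form is a cusp form** (weights add).
[cite: vanderGeer2008, §9 (p. 17 of the held text) "the ideal of cusp forms", §25 (p. 46 L14)]
[cite: Klingen1990, §5 Definition 1 (p. 56)] -/
theorem IsSiegelCuspForm.mul_left (hf : IsSiegelModularForm k₁ f) (hg : IsSiegelCuspForm k₂ g) :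
    IsSiegelCuspForm (k₁ + k₂) (f * g) :=
  ⟨hf.mul hg.1, fun Z hZ => by rw [hf.siegelPhi_mul hg.1 hZ, hg.2 Z hZ, mul_zero]⟩

/-- **Powers of a cusp form are cusp forms**: `f ∈ S^k ⇒ f^m ∈ S^{mk}` for `m ≥ 1`.
[cite: vanderGeer2008, §9 (p. 17 of the held text) "the ideal of cusp forms"] [cite: Klingen1990, §5 Definition 1 (p. 56)] -/
theorem IsSiegelCuspForm.pow (hf : IsSiegelCuspForm k f) {m : ℕ} (hm : m ≠ 0) :
    IsSiegelCuspForm ((m : ℤ) * k) (f ^ m) :=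
  ⟨hf.1.pow m, fun Z hZ => by rw [hf.1.siegelPhi_pow m hZ, hf.2 Z hZ, zero_pow hm]⟩

/-- **`S_{n+1}^{k₁} · M_{n+1}^{k₂} ⊆ S_{n+1}^{k₁+k₂}`** in the tree's linear spaces (`cuspSpace`, `space`): the
cusp forms form an ideal of the graded ring of modular forms.
[cite: vanderGeer2008, §9 (p. 17 of the held text) "the ideal of cusp forms"] [cite: Klingen1990, §5 Definition 1 (p. 56)] -/
theorem mul_mem_cuspSpace (hf : f ∈ cuspSpace (n + 1) k₁) (hg : g ∈ space (n + 1) k₂) :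
    f * g ∈ cuspSpace (n + 1) (k₁ + k₂) :=
  ⟨hf.1.mul (isSiegelModularForm_of_mem_space hg), fun Z hZ => by rw [Pi.mul_apply, hf.2 Z hZ, zero_mul]⟩

/-- **`M_{n+1}^{k₁} · S_{n+1}^{k₂} ⊆ S_{n+1}^{k₁+k₂}`.**
[cite: vanderGeer2008, §9 (p. 17 of the held text) "the ideal of cusp forms"] [cite: Klingen1990, §5 Definition 1 (p. 56)] -/
theorem mul_mem_cuspSpace' (hf : f ∈ space (n + 1) k₁) (hg : g ∈ cuspSpace (n + 1) k₂) :
    f * g ∈ cuspSpace (n + 1) (k₁ + k₂) :=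
  ⟨IsSiegelCuspForm.mul_left (isSiegelModularForm_of_mem_space hf) hg.1,
    fun Z hZ => by rw [Pi.mul_apply, hg.2 Z hZ, mul_zero]⟩

end Ideal

end SiegelModularForm

/-! ### §4 The theta cusp forms `χ = (∏_{m even} ϑ_m)⁸`: `P₈ χ ∈ S_{4+w}`, `χ^m ∈ S_{mw}`, `S_{mw} ≠ 0` -/

section Theta

open SiegelModularForm (siegelPhi IsSiegelModularForm IsSiegelCuspForm)

variable {n : ℕ}

/-- **`P₈ · (∏_{m even} ϑ_m)⁸ ∈ S_{4 + 2^{n+2}(2^{n+1}+1)}(Γ_{n+1})`** (modular × cusp).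
[cite: vanderGeer2008, §7 (p. 15), §9 (p. 17 of the held text)] [cite: Klingen1990, §5 Definition 1 (p. 56)] -/
theorem isSiegelCuspForm_thetaNullEighthPowerSum_mul_evenThetaNullProd_pow_eight :
    IsSiegelCuspForm (4 + 2 ^ (n + 1 + 1) * (2 ^ (n + 1) + 1))
      (thetaNullEighthPowerSum (g := n + 1) * fun Z : Matrix (Fin (n + 1)) (Fin (n + 1)) ℂ => evenThetaNullProd Z ^ 8) :=
  IsSiegelCuspForm.mul_left isSiegelModularForm_thetaNullEighthPowerSum isSiegelCuspForm_evenThetaNullProd_pow_eight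

/-- **`(∏_{m even} ϑ_m)^{8m} ∈ S_{m · 2^{n+2}(2^{n+1}+1)}(Γ_{n+1})` for `m ≥ 1`.**
[cite: vanderGeer2008, §7 (p. 15), §9 (p. 17 of the held text)] [cite: Klingen1990, §5 Definition 1 (p. 56)] -/
theorem isSiegelCuspForm_evenThetaNullProd_pow_eight_mul {m : ℕ} (hm : m ≠ 0) :
    IsSiegelCuspForm ((m : ℤ) * (2 ^ (n + 1 + 1) * (2 ^ (n + 1) + 1)))
      (fun Z : Matrix (Fin (n + 1)) (Fin (n + 1)) ℂ => evenThetaNullProd Z ^ (8 * m)) := by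
  have h := isSiegelCuspForm_evenThetaNullProd_pow_eight.pow hm (n := n)
  have e : (fun Z : Matrix (Fin (n + 1)) (Fin (n + 1)) ℂ => evenThetaNullProd Z ^ 8) ^ m =
      fun Z : Matrix (Fin (n + 1)) (Fin (n + 1)) ℂ => evenThetaNullProd Z ^ (8 * m) := by
    funext Z
    rw [Pi.pow_apply, pow_mul]
  rwa [e] at h

/-- **`S_{m · 2^{n+2}(2^{n+1}+1)}(Γ_{n+1}) ≠ 0` for every `m ≥ 1`**, every degree `n + 1 ≥ 1`: the powers of the
theta cusp form do not vanish identically (they vanish exactly on `θ_null`).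
[cite: vanderGeer2008, §7 (p. 15), §9 (p. 17 of the held text)] [cite: Klingen1990, §5 Definition 1 (p. 56)] -/
theorem exists_isSiegelCuspForm_apply_ne_zero_mul {m : ℕ} (hm : m ≠ 0) :
    ∃ f : Matrix (Fin (n + 1)) (Fin (n + 1)) ℂ → ℂ,
      IsSiegelCuspForm ((m : ℤ) * (2 ^ (n + 1 + 1) * (2 ^ (n + 1) + 1))) f ∧
        ∃ Z ∈ siegelUpperHalfSpace (n + 1), f Z ≠ 0 := by
  obtain ⟨Z, hZ, hne⟩ := exists_evenThetaNullProd_pow_eight_ne_zero (g := n + 1)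
  refine ⟨_, isSiegelCuspForm_evenThetaNullProd_pow_eight_mul hm, Z, hZ, ?_⟩
  rw [pow_mul]
  exact pow_ne_zero m hne

/-- **`Φ(P₈ · F) = 2 P₈ · Φ(F)`** for a modular form `F` of degree `n + 1`: the Siegel operator on the
weight-`4` theta form acts as the scalar `2` on the graded ring.
[cite: vanderGeer2008, §25 (p. 46 L14 of the held text)] [cite: AndrianovZhuravlev2015, Chap. 2 §3.4 Prop. 3.11 (p0077 of the held text)] -/
theorem siegelPhi_thetaNullEighthPowerSum_mul {k : ℤ} {F : Matrix (Fin (n + 1)) (Fin (n + 1)) ℂ → ℂ}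
    (hF : IsSiegelModularForm k F) {Z : Matrix (Fin n) (Fin n) ℂ} (hZ : Z ∈ siegelUpperHalfSpace n) :
    siegelPhi (thetaNullEighthPowerSum (g := n + 1) * F) Z = 2 * thetaNullEighthPowerSum Z * siegelPhi F Z := by
  rw [isSiegelModularForm_thetaNullEighthPowerSum.siegelPhi_mul hF hZ, siegelPhi_thetaNullEighthPowerSum hZ]

end Theta

end Literature.NumberTheory.ModularForms

end
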